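import Summits.ResolutionOfSingularities.ResolutionOfSingularities.Theorems.EquisingularLiftEquisingularLiftNatCarrierDeltaStalks
import Literature.AlgebraicGeometry.Resolution.KollarStrictTransformPieces
import Literature.AlgebraicGeometry.Resolution.PointBlowupOrderChart
import Literature.AlgebraicGeometry.Resolution.PermissibleCentres
import Literature.AlgebraicGeometry.Resolution.MarkedIdealsLemmas
import Literature.AlgebraicGeometry.Resolution.CohenMacaulaySystemsOfParameters
import HarnessLib

/-!
# [OURS · L1 W4.5(b) · EL♮] T-TCONE, part 1: the exceptional fibre of a strict transform under a point blow-up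
# is cut out by the INITIAL FORM (tangent cone) — crux `EquisingularLiftNat` = stmt-ResolutionOfSingularities-20038

HONEST FRAMING. OURS (cell res-hironaka, crux chain w45b, slot W4.5(b)); NOT a statement of any manuscript; AI-written,
weaker than expert review. Helper `--supports stmt-ResolutionOfSingularities-20038 --as helper`; it closes nothing. Object
= res-L1-w45b-lead-2's brick **T-TCONE** (STATUS 2026-08-27T08:06:58Z «for `F` regular at a closed point `x`, `W ∋ x` with
`I(W)_x = (w)`, `d := ord_x w ≥ 1`, `υ = Bl_x`: `υ⁻¹{x} ∩ St(W) = υ⁻¹{x} ∩ St(K̄)` as SETS for the CONE `K̄ := V(in_d w)` …»),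
feeding res-type-100's `HΔ(AdmTC)` (T-CARRIER-Δ (i)(ii)(iv)+(v)); TAKING res-type-097 08:09:46Z. Currency: res-L1-w45b-stub-2's
dictionary `𝒪_{X',x'} ≅ R[I/c_j]_𝔔` (`…CampaignW45bBlowupStalkDictionary`, p506193) and res-type-100's cone-chart / Δ-centre
stalk theorems (`…NatConeChart` p508912, `…NatCarrierDeltaStalks` p509910). THIS IS PART 1 (ideal- and set-level
statements); the REDUCED structure `Z = V(g)`, `g` the square-free part of the initial form, is part 2.

CONTENT («schematic strict transform» = the tree's `strictTransformIdeal τ J K = ⋃ₙ (K·𝒪_{X'} : (J·𝒪_{X'})ⁿ)`, `E = J.comap τ`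
the exceptional ideal, `St ⊔ E` the ideal of the scheme-theoretic intersection `V(E) ∩ V(St)`):
* CHART ALGEBRA `aeval_frac_mem_span_algebraMap_of_coeff_mem`, `span_aeval_frac_sup_eq_of_map_eq`: on `B_j = R[I/c_j]`, forms
  `Φ, Φ₀ ∈ R[T]` with the same reduction modulo `I = (c)` give the same ideal `(Φ(c/c_j)) + (t) = (Φ₀(c/c_j)) + (t)`, `t = c_j/1`.
* `stalkIdeal_strictTransformIdeal_sup_comap_of_presentation`: res-type-100's stalk theorem (p509910) in a GIVEN dictionary
  presentation `(j, 𝔔, χ, e)`: `E_{x'} = (χ t)`, `St(K)_{x'} = (χ Φ(c/c_j))`, `(St(K) ⊔ E)_{x'} = (χ Φ(c/c_j)) + (χ t)`.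
* SUPPORTS (any `τ`, `X'` locally Noetherian) `support_strictTransformIdeal_eq_closure`, `coe_support_strictTransformIdeal_sup_comap`:
  `supp St(K) = closure (τ⁻¹(supp K ∖ supp J))` and `supp (St(K) ⊔ E) = τ⁻¹(supp J) ∩ closure (τ⁻¹(supp K ∖ supp J))` (local
  saturation, tree `stalkIdeal_strictTransformIdeal_eq_top_of_le_radical`; same argument as the tree's
  `S16Proof.AmbientAlongSeqMembers.support_strictTransformIdeal_subset_closure_diff`, re-derived to keep this file's imports lean).
* POINT CENTRE `J = 𝓘_{x}` (`x` closed, `c` a quasi-regular system of generators of `𝔪_x`, e.g. a regular system of parameters,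
  `isQuasiRegular_of_span_eq_maximalIdeal`): `strictTransformIdeal_sup_comap_eq_of_map_eq` — **`E ∩ St(K) = E ∩ St(K₀)` as closed
  SUBSCHEMES of `Bl_x F`** when `K_x = (Φ(c))`, `(K₀)_x = (Φ₀(c))` for forms of the same degree with the same non-zero reduction
  (initial form); `coe_support_strictTransformIdeal_sup_comap_vanishingIdeal` — `supp (St(𝓘_W) ⊔ E) = υ⁻¹{x} ∩ closure (υ⁻¹(W ∖ {x}))`
  (res-L1-w45b-lead-2's set `e ∩ St(W)` of the (TC) constructor); the headline `preimage_inter_closure_eq_of_map_eq` — T-TCONE (1)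
  **`υ⁻¹{x} ∩ closure (υ⁻¹(W ∖ {x})) = υ⁻¹{x} ∩ closure (υ⁻¹(supp K₀ ∖ {x}))`** for every «tangent cone» `K₀` as above; and
  `exists_isHomogeneous_of_stalkIdeal_eq_span` — lead-2's data (`𝒪_{F,x}` regular, `𝓘(W)_x = (w)`, `w ∈ 𝔪ᵈ ∖ 𝔪ᵈ⁺¹`) give the form `Φ`
  (tree `exists_isHomogeneous_eval_eq_map_residue_ne_zero`, Literature `PointBlowupOrderChart.lean`).

References: The Stacks Project, Tags 052Q, 0804, 080E; U. Görtz, T. Wedhorn, *Algebraic Geometry I* (2nd ed. 2020), (13.19)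
[GortzWedhorn2020] — through the cited tree files. res-L1-w45b-lead-2 TARGET T-ISO-0⁺ / skeleton v5.1 (OURS).
-/

set_option linter.dupNamespace false -- mandated namespace `Summit.<Summit>.<Problem>` of this single-conjunct summit

noncomputable section

open CategoryTheory AlgebraicGeometry TopologicalSpace Topology IsLocalRing
open Literature.AlgebraicGeometry.Resolution

namespace Summit.ResolutionOfSingularities.ResolutionOfSingularities.Cruxes.EquisingularLiftNat.Sections

universe u

/-! ## Chart algebra: forms with the same reduction cut out the same trace on the exceptional divisor -/

section Chart

variable {R : Type u} [CommRing R] {r : ℕ} (c : Fin r → R) (j : Fin r)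

/-- On the affine blowup algebra `B_j = R[I/c_j]`, `I = (c)`, a polynomial `Ψ ∈ R[T₁, …, T_r]` all of whose coefficients
lie in `I` evaluates at the fractions `e_l = c_l/c_j` into the exceptional ideal `(t)`, `t = c_j/1` (because
`I·B_j = (t)`, Stacks 052Q). [cite: StacksProject, Tag 052Q] -/
theorem aeval_frac_mem_span_algebraMap_of_coeff_mem {Ψ : MvPolynomial (Fin r) R}
    (hΨ : ∀ m, Ψ.coeff m ∈ Ideal.span (Set.range c)) :
    MvPolynomial.aeval (blowupAlgebra.frac c j) Ψ ∈
      Ideal.span {algebraMap R (blowupAlgebra (Ideal.span (Set.range c)) (c j)) (c j)} := by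
  set B := blowupAlgebra (Ideal.span (Set.range c)) (c j)
  have hmem : Ψ ∈ Ideal.map (MvPolynomial.C : R →+* MvPolynomial (Fin r) R) (Ideal.span (Set.range c)) :=
    MvPolynomial.mem_map_C_iff.mpr hΨ
  have h1 : (MvPolynomial.aeval (blowupAlgebra.frac c j) : MvPolynomial (Fin r) R →ₐ[R] B).toRingHom Ψ ∈
      (Ideal.map (MvPolynomial.C : R →+* MvPolynomial (Fin r) R) (Ideal.span (Set.range c))).map
        (MvPolynomial.aeval (blowupAlgebra.frac c j) : MvPolynomial (Fin r) R →ₐ[R] B).toRingHom :=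
    Ideal.mem_map_of_mem _ hmem
  rw [Ideal.map_map] at h1
  have hcomp : (MvPolynomial.aeval (blowupAlgebra.frac c j) : MvPolynomial (Fin r) R →ₐ[R] B).toRingHom.comp
      MvPolynomial.C = algebraMap R B := by
    ext a
    simp
  rw [hcomp, map_blowupAlgebra_eq_span (Ideal.subset_span (Set.mem_range_self j))] at h1
  exact h1

/-- **Forms with the same reduction modulo `I = (c)` have the same trace ideal on the exceptional divisor of the chart**:
if `Φ̄ = Φ̄₀` in `(R/I)[T]` then `(Φ(c/c_j)) + (t) = (Φ₀(c/c_j)) + (t)` in `B_j = R[I/c_j]`, `t = c_j/1`. For a point centre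
(`I = 𝔪`, `Φ̄ =` the initial form) this says: the intersection of the strict transform with the exceptional divisor only depends
on the initial form. [folklore] [cite: StacksProject, Tag 052Q] -/
theorem span_aeval_frac_sup_eq_of_map_eq {Φ Φ₀ : MvPolynomial (Fin r) R}
    (h : MvPolynomial.map (Ideal.Quotient.mk (Ideal.span (Set.range c))) Φ =
      MvPolynomial.map (Ideal.Quotient.mk (Ideal.span (Set.range c))) Φ₀) :
    Ideal.span {MvPolynomial.aeval (blowupAlgebra.frac c j) Φ} ⊔
        Ideal.span {algebraMap R (blowupAlgebra (Ideal.span (Set.range c)) (c j)) (c j)} =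
      Ideal.span {MvPolynomial.aeval (blowupAlgebra.frac c j) Φ₀} ⊔
        Ideal.span {algebraMap R (blowupAlgebra (Ideal.span (Set.range c)) (c j)) (c j)} := by
  have hcoeff : ∀ Ψ Ψ₀ : MvPolynomial (Fin r) R,
      MvPolynomial.map (Ideal.Quotient.mk (Ideal.span (Set.range c))) Ψ =
        MvPolynomial.map (Ideal.Quotient.mk (Ideal.span (Set.range c))) Ψ₀ →
      ∀ m, (Ψ - Ψ₀).coeff m ∈ Ideal.span (Set.range c) := by
    intro Ψ Ψ₀ hΨ m
    have := congrArg (MvPolynomial.coeff m) hΨ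
    rw [MvPolynomial.coeff_map, MvPolynomial.coeff_map] at this
    rw [MvPolynomial.coeff_sub]
    exact Ideal.Quotient.eq.mp this
  have key : ∀ Ψ Ψ₀ : MvPolynomial (Fin r) R,
      MvPolynomial.map (Ideal.Quotient.mk (Ideal.span (Set.range c))) Ψ =
        MvPolynomial.map (Ideal.Quotient.mk (Ideal.span (Set.range c))) Ψ₀ →
      Ideal.span {MvPolynomial.aeval (blowupAlgebra.frac c j) Ψ} ≤
        Ideal.span {MvPolynomial.aeval (blowupAlgebra.frac c j) Ψ₀} ⊔
          Ideal.span {algebraMap R (blowupAlgebra (Ideal.span (Set.range c)) (c j)) (c j)} := by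
    intro Ψ Ψ₀ hΨ
    rw [Ideal.span_singleton_le_iff_mem]
    have hdiff := aeval_frac_mem_span_algebraMap_of_coeff_mem c j (hcoeff Ψ Ψ₀ hΨ)
    rw [map_sub] at hdiff
    have : MvPolynomial.aeval (blowupAlgebra.frac c j) Ψ =
        MvPolynomial.aeval (blowupAlgebra.frac c j) Ψ₀ +
          (MvPolynomial.aeval (blowupAlgebra.frac c j) Ψ - MvPolynomial.aeval (blowupAlgebra.frac c j) Ψ₀) := by
      ring
    rw [this]
    exact Submodule.add_mem_sup (Ideal.mem_span_singleton_self _) hdiff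
  exact le_antisymm (sup_le (key Φ Φ₀ h) le_sup_right) (sup_le (key Φ₀ Φ h.symm) le_sup_right)

end Chart

/-! ## Stalks of `St(K) ⊔ E` in a GIVEN dictionary presentation -/

section Presentation

variable {X X' : Scheme.{u}} {τ : X' ⟶ X} {J : X.IdealSheafData}

set_option maxHeartbeats 400000 in -- the chart algebra `blowupAlgebra` is a subalgebra of a localisation: slow instance unification (cf. p506193, p509910)
/-- **res-type-100's stalk theorem in a given presentation.** Let `τ : X' → X` be a morphism, `J, K` ideal sheaves on `X`,
`X'` locally Noetherian, `x' ∈ X'`. At `R = 𝒪_{X,τ x'}` suppose `J_{τ x'} = (c₁, …, c_r)` with `c` quasi-regular and `R/(c)` a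
domain, and `K_{τ x'} = (Φ(c))` for a form `Φ` of degree `d` with non-zero reduction `Φ̄ ∈ (R/(c))[T]`. Then for EVERY chart
index `j`, prime `𝔔` of `B = R[I/c_j]`, ring map `χ : B → 𝒪_{X',x'}` extending `τ^♯_{x'}` and ring isomorphism
`e : 𝒪_{X',x'} ≅ B_𝔔` with `e ∘ χ = (· /1)`: `E_{x'} = (χ t)`, `St(K)_{x'} = (χ Φ(c/c_j))` and
`(St(K) ⊔ E)_{x'} = (χ Φ(c/c_j)) + (χ t)` (`t = c_j/1`). Proof = res-type-100's `exists_stalk_strictTransformIdeal_sup_comap`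
(p509910) with the presentation supplied instead of produced. [cite: StacksProject, Tag 0804] -/
theorem stalkIdeal_strictTransformIdeal_sup_comap_of_presentation [IsLocallyNoetherian X']
    (K : X.IdealSheafData) (x' : X') {r : ℕ}
    (c : Fin r → X.presheaf.stalk (τ x')) (hcJ : Ideal.span (Set.range c) = stalkIdeal J (τ x'))
    (hc : IsQuasiRegular c) [IsDomain (X.presheaf.stalk (τ x') ⧸ Ideal.span (Set.range c))]
    {d : ℕ} (Φ : MvPolynomial (Fin r) (X.presheaf.stalk (τ x'))) (hΦd : Φ.IsHomogeneous d)
    (hΦ : MvPolynomial.map (Ideal.Quotient.mk (Ideal.span (Set.range c))) Φ ≠ 0)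
    (hK : stalkIdeal K (τ x') = Ideal.span {MvPolynomial.eval c Φ})
    (j : Fin r) (𝔔 : PrimeSpectrum (blowupAlgebra (Ideal.span (Set.range c)) (c j)))
    (χ : blowupAlgebra (Ideal.span (Set.range c)) (c j) →+* X'.presheaf.stalk x')
    (e : X'.presheaf.stalk x' ≃+* Localization.AtPrime 𝔔.asIdeal)
    (hχ : ∀ a, χ (algebraMap _ _ a) = (τ.stalkMap x').hom a)
    (he : ∀ b, e (χ b) = algebraMap _ (Localization.AtPrime 𝔔.asIdeal) b) :
    stalkIdeal (J.comap τ) x' =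
        Ideal.span {χ (algebraMap _ (blowupAlgebra (Ideal.span (Set.range c)) (c j)) (c j))} ∧
      stalkIdeal (strictTransformIdeal τ J K) x' =
        Ideal.span {χ (MvPolynomial.aeval (blowupAlgebra.frac c j) Φ)} ∧
      stalkIdeal (strictTransformIdeal τ J K ⊔ J.comap τ) x' =
        Ideal.span {χ (MvPolynomial.aeval (blowupAlgebra.frac c j) Φ)} ⊔
          Ideal.span {χ (algebraMap _ (blowupAlgebra (Ideal.span (Set.range c)) (c j)) (c j))} := by
  letI := χ.toAlgebra
  haveI : IsLocalization.AtPrime (X'.presheaf.stalk x') 𝔔.asIdeal := isLocalization_stalk_of_ringEquiv 𝔔 x' χ e he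
  have hstalkMap : (τ.stalkMap x').hom =
      χ.comp (algebraMap _ (blowupAlgebra (Ideal.span (Set.range c)) (c j))) :=
    RingHom.ext fun a => (hχ a).symm
  have hE : stalkIdeal (J.comap τ) x' =
      Ideal.span {χ (algebraMap _ (blowupAlgebra (Ideal.span (Set.range c)) (c j)) (c j))} := by
    rw [stalkIdeal_comap_eq_map_stalkMap, ← hcJ, hstalkMap, ← Ideal.map_map,
      map_blowupAlgebra_eq_span (Ideal.subset_span (Set.mem_range_self j)), Ideal.map_span, Set.image_singleton]
  have hΦj : MvPolynomial.map (Ideal.Quotient.mk (Ideal.span (Set.range c))) (dehomogenize j Φ) ≠ 0 := by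
    rw [map_dehomogenize]
    exact dehomogenize_ne_zero_of_isHomogeneous j (hΦd.map _) hΦ
  have hSt : stalkIdeal (strictTransformIdeal τ J K) x' =
      Ideal.span {χ (MvPolynomial.aeval (blowupAlgebra.frac c j) Φ)} := by
    rw [stalkIdeal_strictTransformIdeal, hE, hK, Ideal.map_span, Set.image_singleton, hstalkMap]
    exact iSup_colon_span_eval_eq_span_coneTransform_localization c j hc hΦd hΦj 𝔔.asIdeal.primeCompl
      (X'.presheaf.stalk x')
  refine ⟨hE, hSt, ?_⟩
  rw [stalkIdeal_sup, hSt, hE]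

end Presentation

/-! ## Supports: the schematic strict transform is supported on the topological strict transform -/

section Support

variable {X X' : Scheme.{u}} (τ : X' ⟶ X) (J K : X.IdealSheafData)

/-- **Local saturation ⇒ no component of `V(St(K))` inside the exceptional locus**: for `X'` locally Noetherian,
`supp St(K) ⊆ closure (supp St(K) ∖ supp E)` (a point of `supp St(K)` off that closure would have `E_s ⊆ √St(K)_s`, whence
`St(K)_s = ⊤` by `stalkIdeal_strictTransformIdeal_eq_top_of_le_radical`). [cite: GortzWedhorn2020, (13.19) p. 414] -/
theorem support_strictTransformIdeal_subset_closure_diff' [IsLocallyNoetherian X'] :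
    ((strictTransformIdeal τ J K).support : Set X') ⊆
      closure (((strictTransformIdeal τ J K).support : Set X') \ (J.comap τ).support) := by
  classical
  set S := strictTransformIdeal τ J K with hS
  set F := J.comap τ with hF
  intro s hs
  by_contra hsD
  set D : Closeds X' := ⟨closure ((S.support : Set X') \ F.support), isClosed_closure⟩ with hD
  have hsJ : s ∉ ((Scheme.IdealSheafData.vanishingIdeal D).support : Set X') := by
    rw [Scheme.IdealSheafData.coe_support_vanishingIdeal]; exact hsD
  have hJtop : stalkIdeal (Scheme.IdealSheafData.vanishingIdeal D) s = ⊤ :=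
    stalkIdeal_eq_top_of_not_mem_support hsJ
  have hsupp : S.support ≤ (F * Scheme.IdealSheafData.vanishingIdeal D).support := by
    intro x hx
    rw [Scheme.IdealSheafData.support_mul]
    by_cases hxF : x ∈ F.support
    · exact Or.inl hxF
    · refine Or.inr ?_
      show x ∈ ((Scheme.IdealSheafData.vanishingIdeal D).support : Set X')
      rw [Scheme.IdealSheafData.coe_support_vanishingIdeal]
      exact subset_closure ⟨hx, hxF⟩
  have hle : F * Scheme.IdealSheafData.vanishingIdeal D ≤ S.radical := by
    rw [← Scheme.IdealSheafData.vanishingIdeal_support]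
    exact (Scheme.IdealSheafData.le_support_iff_le_vanishingIdeal.mp le_rfl).trans
      (Scheme.IdealSheafData.vanishingIdeal_antimono hsupp)
  have hrad : stalkIdeal F s ≤ (stalkIdeal S s).radical := by
    have h1 := stalkIdeal_mono hle s
    rw [stalkIdeal_mul, hJtop, Ideal.mul_top, stalkIdeal_radical] at h1
    exact h1
  have htop : stalkIdeal S s = ⊤ := stalkIdeal_strictTransformIdeal_eq_top_of_le_radical τ J K hrad
  have := (mem_support_iff_stalkIdeal_le S s).mp hs
  rw [htop, top_le_iff] at this
  exact (maximalIdeal.isMaximal (X'.presheaf.stalk s)).ne_top this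

/-- Off the exceptional locus the schematic strict transform is supported exactly over `supp K`: for `x' ∉ supp E`,
`x' ∈ supp St(K) ↔ τ x' ∈ supp K` (there `St(K)_{x'} = K_{τ x'}·𝒪_{X',x'}`, `stalkIdeal_strictTransformIdeal_of_not_mem`).
[folklore] -/
theorem mem_support_strictTransformIdeal_iff_of_not_mem_comap [IsLocallyNoetherian X'] {x' : X'}
    (hx' : x' ∉ (J.comap τ).support) :
    x' ∈ (strictTransformIdeal τ J K).support ↔ τ x' ∈ K.support := by
  rw [mem_support_iff_stalkIdeal_le, mem_support_iff_stalkIdeal_le,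
    stalkIdeal_strictTransformIdeal_of_not_mem τ J K hx']
  constructor
  · intro h
    by_contra hK
    have hKtop : stalkIdeal K (τ x') = ⊤ := by
      by_contra hne
      exact hK (IsLocalRing.le_maximalIdeal hne)
    rw [hKtop, Ideal.map_top, top_le_iff] at h
    exact (maximalIdeal.isMaximal (X'.presheaf.stalk x')).ne_top h
  · intro h
    exact (Ideal.map_mono h).trans (IsLocalRing.map_maximalIdeal_le _)

/-- **The support of the schematic strict transform is the topological strict transform**: for `X'` locally Noetherian,
`supp St(K) = closure (τ⁻¹(supp K ∖ supp J))`. [cite: GortzWedhorn2020, (13.19) p. 414] -/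
theorem support_strictTransformIdeal_eq_closure [IsLocallyNoetherian X'] :
    ((strictTransformIdeal τ J K).support : Set X') = closure (τ ⁻¹' ((K.support : Set X) \ J.support)) := by
  have hdiff : ((strictTransformIdeal τ J K).support : Set X') \ (J.comap τ).support =
      τ ⁻¹' ((K.support : Set X) \ J.support) := by
    ext x'
    have hE : x' ∈ ((J.comap τ).support : Set X') ↔ τ x' ∈ (J.support : Set X) := by
      rw [Scheme.IdealSheafData.support_comap]; rfl
    constructor
    · rintro ⟨h1, h2⟩
      exact ⟨(mem_support_strictTransformIdeal_iff_of_not_mem_comap τ J K h2).mp h1, fun h => h2 (hE.mpr h)⟩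
    · rintro ⟨h1, h2⟩
      have h2' : x' ∉ ((J.comap τ).support : Set X') := fun h => h2 (hE.mp h)
      exact ⟨(mem_support_strictTransformIdeal_iff_of_not_mem_comap τ J K h2').mpr h1, h2'⟩
  apply le_antisymm
  · rw [← hdiff]
    exact support_strictTransformIdeal_subset_closure_diff' τ J K
  · rw [← hdiff]
    exact closure_minimal (fun _ h => h.1) (strictTransformIdeal τ J K).support.isClosed

/-- **The support of `St(K) ⊔ E`** (the ideal of the scheme-theoretic intersection of the strict transform with the exceptional
locus): `supp (St(K) ⊔ E) = τ⁻¹(supp J) ∩ closure (τ⁻¹(supp K ∖ supp J))`. [folklore] -/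
theorem coe_support_strictTransformIdeal_sup_comap [IsLocallyNoetherian X'] :
    ((strictTransformIdeal τ J K ⊔ J.comap τ).support : Set X') =
      τ ⁻¹' (J.support : Set X) ∩ closure (τ ⁻¹' ((K.support : Set X) \ J.support)) := by
  rw [Scheme.IdealSheafData.support_sup, Closeds.coe_inf, support_strictTransformIdeal_eq_closure,
    Scheme.IdealSheafData.support_comap, Set.inter_comm]
  rfl

end Support

/-! ## Point centres: `E ∩ St(W)` only depends on the initial form -/

section PointCentre

variable {F F' : Scheme.{u}} {υ : F' ⟶ F} {x : F} (hx : IsClosed ({x} : Set F))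

/-- The quotient of `𝒪_{F,x}` by a system of generators of `𝔪_x` is a domain (a field). [folklore] -/
theorem isDomain_quotient_span_of_span_eq_maximalIdeal {r : ℕ} {c : Fin r → F.presheaf.stalk x}
    (hc𝔪 : Ideal.span (Set.range c) = maximalIdeal (F.presheaf.stalk x)) :
    IsDomain (F.presheaf.stalk x ⧸ Ideal.span (Set.range c)) :=
  haveI : (Ideal.span (Set.range c)).IsMaximal := hc𝔪 ▸ maximalIdeal.isMaximal _; Ideal.Quotient.isDomain _

/-- **`E ∩ St(K) = E ∩ St(K₀)` as closed subschemes of the point blow-up `F' = Bl_x F`, when `K` and `K₀` have the same initial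
form at `x`.** Let `υ : F' → F` be the blow-up of the closed point `x` (`IsBlowup υ 𝓘_{x}`), `F'` locally Noetherian,
`c = (c₁, …, c_r)` a quasi-regular system of generators of `𝔪_x` (e.g. a regular system of parameters of a regular `𝒪_{F,x}`),
and `K, K₀` ideal sheaves with `K_x = (Φ(c))`, `(K₀)_x = (Φ₀(c))` for forms `Φ, Φ₀ ∈ 𝒪_{F,x}[T]` of the same degree `d` with
the same non-zero reduction `Φ̄ = Φ̄₀ ∈ κ(x)[T]`. Then `St(K) ⊔ E = St(K₀) ⊔ E` (`E = 𝓘_{x}·𝒪_{F'}`); e.g. `K = 𝓘_W`, `w = Φ(c)` a local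
equation of order `d`, `K₀` any «tangent cone» ideal with local equation `Φ₀(c)` lifting `in_d w = Φ̄`. [cite: StacksProject, Tag 0804] -/
theorem strictTransformIdeal_sup_comap_eq_of_map_eq [IsLocallyNoetherian F']
    (hυ : IsBlowup υ (Scheme.IdealSheafData.vanishingIdeal ⟨{x}, hx⟩)) {r : ℕ}
    (c : Fin r → F.presheaf.stalk x) (hc𝔪 : Ideal.span (Set.range c) = maximalIdeal (F.presheaf.stalk x))
    (hc : IsQuasiRegular c) (K K₀ : F.IdealSheafData) {d : ℕ}
    (Φ Φ₀ : MvPolynomial (Fin r) (F.presheaf.stalk x)) (hΦd : Φ.IsHomogeneous d) (hΦ₀d : Φ₀.IsHomogeneous d)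
    (hred : MvPolynomial.map (Ideal.Quotient.mk (Ideal.span (Set.range c))) Φ =
      MvPolynomial.map (Ideal.Quotient.mk (Ideal.span (Set.range c))) Φ₀)
    (hΦ : MvPolynomial.map (Ideal.Quotient.mk (Ideal.span (Set.range c))) Φ ≠ 0)
    (hK : stalkIdeal K x = Ideal.span {MvPolynomial.eval c Φ})
    (hK₀ : stalkIdeal K₀ x = Ideal.span {MvPolynomial.eval c Φ₀}) :
    strictTransformIdeal υ (Scheme.IdealSheafData.vanishingIdeal ⟨{x}, hx⟩) K ⊔
        (Scheme.IdealSheafData.vanishingIdeal ⟨{x}, hx⟩).comap υ =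
      strictTransformIdeal υ (Scheme.IdealSheafData.vanishingIdeal ⟨{x}, hx⟩) K₀ ⊔
        (Scheme.IdealSheafData.vanishingIdeal ⟨{x}, hx⟩).comap υ := by
  set J := Scheme.IdealSheafData.vanishingIdeal (⟨{x}, hx⟩ : Closeds F) with hJ
  have hΦ₀ : MvPolynomial.map (Ideal.Quotient.mk (Ideal.span (Set.range c))) Φ₀ ≠ 0 := hred ▸ hΦ
  refine ext_of_forall_stalkIdeal_eq fun x' => ?_
  by_cases hx' : υ x' ∈ (J.support : Set F)
  · have hxx : υ x' = x := by
      rw [hJ, Scheme.IdealSheafData.coe_support_vanishingIdeal] at hx'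
      exact hx'
    subst hxx
    haveI := isDomain_quotient_span_of_span_eq_maximalIdeal hc𝔪
    have hcJ : Ideal.span (Set.range c) = stalkIdeal J (υ x') := by rw [hc𝔪, hJ, stalkIdeal_vanishingIdeal_singleton hx]
    obtain ⟨j, 𝔔, χ, e, hχ, he, -⟩ :=
      exists_blowupAlgebra_stalk_ringEquiv_of_eq hυ x' c (Ideal.span (Set.range c)) rfl hcJ
    obtain ⟨-, -, h1⟩ := stalkIdeal_strictTransformIdeal_sup_comap_of_presentation K x' c hcJ hc Φ hΦd hΦ hK
      j 𝔔 χ e hχ he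
    obtain ⟨-, -, h2⟩ := stalkIdeal_strictTransformIdeal_sup_comap_of_presentation K₀ x' c hcJ hc Φ₀ hΦ₀d hΦ₀ hK₀
      j 𝔔 χ e hχ he
    have key := congrArg (Ideal.map χ) (span_aeval_frac_sup_eq_of_map_eq c j hred)
    simp only [Ideal.map_sup, Ideal.map_span, Set.image_singleton] at key
    rw [h1, h2, key]
  · have hE : stalkIdeal (J.comap υ) x' = ⊤ := by
      apply stalkIdeal_eq_top_of_not_mem_support
      intro h
      apply hx'
      have : x' ∈ ((J.comap υ).support : Set F') := h
      rw [Scheme.IdealSheafData.support_comap] at this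
      exact this
    rw [stalkIdeal_sup, stalkIdeal_sup, hE, sup_top_eq, sup_top_eq]

/-- **The `Z`-set of the (TC) constructor.** For the blow-up `υ : F' → F` of a closed point `x` (`F'` locally Noetherian) and
a closed `W ⊆ F`: `supp (St(𝓘_W) ⊔ E) = υ⁻¹{x} ∩ closure (υ⁻¹(W ∖ {x}))` — res-L1-w45b-lead-2's set
`e ∩ St(W)`, `e = υ⁻¹{x}`, with `St(W)` the topological strict transform. (No cone hypothesis needed.) [folklore] -/
theorem coe_support_strictTransformIdeal_sup_comap_vanishingIdeal [IsLocallyNoetherian F'] (W : Closeds F) :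
    ((strictTransformIdeal υ (Scheme.IdealSheafData.vanishingIdeal ⟨{x}, hx⟩)
          (Scheme.IdealSheafData.vanishingIdeal W) ⊔
        (Scheme.IdealSheafData.vanishingIdeal ⟨{x}, hx⟩).comap υ).support : Set F') =
      υ ⁻¹' {x} ∩ closure (υ ⁻¹' ((W : Set F) \ {x})) := by
  rw [coe_support_strictTransformIdeal_sup_comap, Scheme.IdealSheafData.coe_support_vanishingIdeal,
    Scheme.IdealSheafData.coe_support_vanishingIdeal]
  rfl

/-- **T-TCONE (1): `υ⁻¹{x} ∩ St(W) = υ⁻¹{x} ∩ St(K̄)` as SETS.** In the situation of `strictTransformIdeal_sup_comap_eq_of_map_eq`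
with `K = 𝓘_W` for a closed `W ∋ x` (local equation `w = Φ(c)` of order `d`, `𝓘(W)_x = (Φ(c))`) and ANY ideal sheaf `K₀` with
`(K₀)_x = (Φ₀(c))`, `Φ₀` a form of degree `d` with the same reduction (a «tangent cone» `K̄ = V(in_d w)` near `x`):
`υ⁻¹{x} ∩ closure (υ⁻¹(W ∖ {x})) = υ⁻¹{x} ∩ closure (υ⁻¹(supp K₀ ∖ {x}))`. [folklore] -/
theorem preimage_inter_closure_eq_of_map_eq [IsLocallyNoetherian F']
    (hυ : IsBlowup υ (Scheme.IdealSheafData.vanishingIdeal ⟨{x}, hx⟩)) {r : ℕ}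
    (c : Fin r → F.presheaf.stalk x) (hc𝔪 : Ideal.span (Set.range c) = maximalIdeal (F.presheaf.stalk x))
    (hc : IsQuasiRegular c) (W : Closeds F) (K₀ : F.IdealSheafData) {d : ℕ}
    (Φ Φ₀ : MvPolynomial (Fin r) (F.presheaf.stalk x)) (hΦd : Φ.IsHomogeneous d) (hΦ₀d : Φ₀.IsHomogeneous d)
    (hred : MvPolynomial.map (Ideal.Quotient.mk (Ideal.span (Set.range c))) Φ =
      MvPolynomial.map (Ideal.Quotient.mk (Ideal.span (Set.range c))) Φ₀)
    (hΦ : MvPolynomial.map (Ideal.Quotient.mk (Ideal.span (Set.range c))) Φ ≠ 0)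
    (hW : stalkIdeal (Scheme.IdealSheafData.vanishingIdeal W) x = Ideal.span {MvPolynomial.eval c Φ})
    (hK₀ : stalkIdeal K₀ x = Ideal.span {MvPolynomial.eval c Φ₀}) :
    υ ⁻¹' {x} ∩ closure (υ ⁻¹' ((W : Set F) \ {x})) =
      υ ⁻¹' {x} ∩ closure (υ ⁻¹' ((K₀.support : Set F) \ {x})) := by
  rw [← coe_support_strictTransformIdeal_sup_comap_vanishingIdeal hx W,
    strictTransformIdeal_sup_comap_eq_of_map_eq hx hυ c hc𝔪 hc _ K₀ Φ Φ₀ hΦd hΦ₀d hred hΦ hW hK₀,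
    coe_support_strictTransformIdeal_sup_comap, Scheme.IdealSheafData.coe_support_vanishingIdeal]
  rfl

/-- **The cone hypothesis from res-L1-w45b-lead-2's data.** If `𝒪_{F,x}` is a regular local ring, `c` a system of generators of
`𝔪_x`, and the closed `W` has a local equation `w` at `x` (`𝓘(W)_x = (w)`) of order exactly `d` (`w ∈ 𝔪ᵈ ∖ 𝔪ᵈ⁺¹`), then
`w = Φ(c)` for a form `Φ` of degree `d` with non-zero reduction `Φ̄ ∈ κ(x)[T]` — the initial form `in_d w` — so that
`𝓘(W)_x = (Φ(c))` as the theorems above require (tree `exists_isHomogeneous_eval_eq_map_residue_ne_zero`,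
Literature `PointBlowupOrderChart.lean`). [cite: CossartPiltant2008, proof of Prop. 4.2, (10)] -/
theorem exists_isHomogeneous_of_stalkIdeal_eq_span [IsRegularLocalRing (F.presheaf.stalk x)] {r : ℕ}
    (c : Fin r → F.presheaf.stalk x) (hc𝔪 : Ideal.span (Set.range c) = maximalIdeal (F.presheaf.stalk x))
    (K : F.IdealSheafData) {w : F.presheaf.stalk x} (hK : stalkIdeal K x = Ideal.span {w}) {d : ℕ}
    (hw : w ∈ maximalIdeal (F.presheaf.stalk x) ^ d) (hw' : w ∉ maximalIdeal (F.presheaf.stalk x) ^ (d + 1)) :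
    ∃ Φ : MvPolynomial (Fin r) (F.presheaf.stalk x), Φ.IsHomogeneous d ∧ MvPolynomial.eval c Φ = w ∧
      MvPolynomial.map (Ideal.Quotient.mk (Ideal.span (Set.range c))) Φ ≠ 0 ∧
      stalkIdeal K x = Ideal.span {MvPolynomial.eval c Φ} := by
  obtain ⟨Φ, hΦd, hΦw, hΦ⟩ := exists_isHomogeneous_eval_eq_map_residue_ne_zero c hc𝔪 hw hw'
  exact ⟨Φ, hΦd, hΦw, hΦ, by rw [hK, hΦw]⟩

/-- A regular system of parameters of the regular local ring `𝒪_{F,x}` (a system of `dim 𝒪_{F,x}` generators of `𝔪_x`) is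
quasi-regular — the hypothesis `hc` of the theorems above (regular ⇒ Cohen–Macaulay, tree `cmClause_of_isRegularLocalRing`,
and Rees' theorem, tree `isQuasiRegular_of_isWeaklyRegular`; cf. `isQuasiRegular_of_radical_isMaximal`).
[cite: Matsumura1987, Thm. 17.8 with Thm. 16.2 (i)] -/
theorem isQuasiRegular_of_span_eq_maximalIdeal [IsRegularLocalRing (F.presheaf.stalk x)] {r : ℕ}
    (hr : ringKrullDim (F.presheaf.stalk x) = r) (c : Fin r → F.presheaf.stalk x)
    (hc𝔪 : Ideal.span (Set.range c) = maximalIdeal (F.presheaf.stalk x)) : IsQuasiRegular c := by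
  refine isQuasiRegular_of_isWeaklyRegular c (cmClause_of_isRegularLocalRing (F.presheaf.stalk x) r hr c ?_)
  rw [hc𝔪, (maximalIdeal.isMaximal _).isPrime.radical]
  exact maximalIdeal.isMaximal _

end PointCentre

end Summit.ResolutionOfSingularities.ResolutionOfSingularities.Cruxes.EquisingularLiftNat.Sections

end
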